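import Summits.HodgeConjecture.HodgeConjecture.Theorems.F0P3cStCharTSUpTrJacCartanCompactH  -- ★ (H4c-3) p852433 (LH10-p02 (g10)): `mul_comm_cmDatum_local_one`, `isRegularElt_fst_of_isLocalGRegular`, `measurable_sqrt_radicandTwo`; brings ★ (H4c-2) `Literature.MeasureTheory.Group.TubeJacobianProductCompact` (`tubeJacobianLocal_prod_compactFactor`), ★ `…WeylHypMeasure` (`exists_conjFamily`), ★ `LocalTransferUnmatchedLocus`, ★ `LocalUnitaryGroupCongrMeasure`
import Summits.HodgeConjecture.HodgeConjecture.Theorems.F0P3cStCharTSUpTrJacSplitModelTwo   -- ★ (B8-D) FILE A (LH6-p04 (g7)): `tubeJacobianLocal_splitCartan_U2` — the `U(Φ₂)_v` socket at the split torus, unconditional (road «JAC-LOC₂» (B1)–(B7b))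
import Literature.NumberTheory.Automorphic.CMTorusRegularAEPrelims                           -- ★ `isClosed_torusU_of_t1Space`
import Literature.NumberTheory.Automorphic.JacquetNonzeroEmbedsNormalizedInd                 -- ★ `torusU_mul_comm`
import HarnessLib

/-!
# F0 · P3c · ROAD «UP-TR» brick (H4s) «JAC-H-SPLIT» — TERMINUS: the local tube-Jacobian socket on `H_v = U(Φ₂)(L⁺_v) × U(Φ₁)(L⁺_v)` AT THE SPLIT CARTAN
# `M_H = M × U(Φ₁)(L⁺_v)`, in the signed letters (Harish-Chandra 1970 Lemma 22; van Dijk 1972 §2; Rogawski 1990 §12.5 pp. 182–183) — MODULO THE `N = 2` SPLIT DOCK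

Cell `pub/hodgecm-mathlib`, crux H413 = `stmt-HodgeConjecture-24833` (lane `--supports … --as helper`); seat LH7-p02 (g8), typing hand of (H4s) (ROAD «UP-TR» DEAL #1,
holder F0P3-p02 (g23) 2026-09-02T18:18:30Z) and sub-dealer of «JAC-LOC₂» (`F0/P3c/LH7/LH7-p02/g8/h4s/ROAD-JAC-LOC2.v1.LH7p02g8.md`); letters ★-signed by the JAC-LOC
lineage LH6-p03 (g6) (sigsheet `UPTR-H4s-socket.sigsheet.v1.LH6p03g6.lean` 9bf0eb0528a2264c).  THEOREMS ONLY; sorry-free; no definition ∕ instance ∕ notation ∕ named fact; axioms TRIO.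

THE POINT.  (H3e) `…UpTrJacobian` and (H5) `…UpTrWIFH` consume ONE analytic input per Cartan subgroup of `H_v`: the local tube-Jacobian socket `hJac`.  At the SPLIT Cartan
`M_H = M.prod ⊤` (`M = (cmBorelTriple L 2 v).M ≅ L_w^×` the diagonal torus of `U(Φ₂)_v`) the C8 Cayley-chart engine covers only the compact core (★ p852388), so the
`U(Φ₂)`-socket at `M` is the van Dijk ∕ levels road «JAC-LOC₂» ((B1)–(B7), (B8-D)); this file is the (H4s) TERMINUS: **`tubeJacobianLocal_splitCartanH_of_dock`** — GIVEN the
`U(Φ₂)_v`-socket at `M` for all Haar data with weight `√(∏_w |disc χ_t|_w · (∏_w |det t|_w)⁻¹)` (hypothesis `hDock` = the head of (B8-D) `…UpTrU2SplitDock.tubeJacobianLocal_cartan_U2_split`,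
LH6-p04 (g7)), the letter holds token for token: for `T = M.prod ⊤`, every conjugation family `Φ`, every Haar `tm` on `T`, every weight `D` with `D t = dh(t)²`, every `G`-regular
`t₀ ∈ T` has an open `U ∋ t₀` and a Borel `A₀ ⊆ H_v ⧸ T` of positive finite quotient mass with `νHv (Φ(A₀ × V)) = (νHv∕tm)(A₀) · ∫⁻_V D dtm` for all Borel `G`-regular `W`-free `V ⊆ U`.
PROOF = ★ (H4c-2) `tubeJacobianLocal_prod_compactFactor` at `G₂ = U(Φ₂)_v`, `K = U(Φ₁)_v` (compact ★, abelian), `T₂ = M` (closed ★ `isClosed_torusU_of_t1Space`, abelian ★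
`torusU_mul_comm`), `R = IsLocalGRegular L v`, `R₂ = IsRegularElt` (`G`-regular ⇒ separable `2 × 2` characteristic polynomial, ★ `IsLocalGRegular.separable_finCharpolyTwo`),
`D₂ = √radicand` (Borel: ★ `continuous_dgFormulaTwo`), after the instance surgery of ★ (H4c-3) (the letter's Borel structure on the product IS the product of the Borel structures —
second countability); the factor algebra (`U(Φ₁)_v` abelian, `G`-regular ⇒ `IsRegularElt`, Borel weight) is ★ (H4c-3) §1 by name.  The unconditional terminus `tubeJacobianLocal_splitCartanH` = this ∘ (B8-D) (next edition, when (B8-D) is ★).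
HONEST LABEL: count-neutral; conditional on `hDock` until (B8-D) lands; closes no organ by itself; HC_CM is proved only modulo the 7 printed citations (2 remaining: hLiu418 =
`stmt-HodgeConjecture-24832`, h413 = `stmt-HodgeConjecture-24833`) until rung 0 closes.

## References
* [HarishChandra1970] Harish-Chandra (notes by G. van Dijk), *Harmonic analysis on reductive p-adic groups*, LNM 162 (1970), Part V §4 Lemma 22.
* [vanDijk1972] G. van Dijk, *Computation of certain induced characters of p-adic groups*, Math. Ann. 199 (1972), §2.
* [Rogawski1990] J. D. Rogawski, *Automorphic Representations of Unitary Groups in Three Variables*, Ann. of Math. Stud. 123 (1990), §12.5 pp. 182–183; §4.9 p. 54.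
* [Folland1995] G. B. Folland, *A Course in Abstract Harmonic Analysis* (1995), §2.6 Thm. 2.49 (quotient integral formula).
-/

set_option autoImplicit false
-- the mandated namespace has the single-problem summit's repeated segment (`HodgeConjecture.HodgeConjecture`)
set_option linter.dupNamespace false

noncomputable section

open MeasureTheory Measure Set Filter Topology NumberField IsDedekindDomain
open Literature.MeasureTheory.Group
open Literature.NumberTheory Literature.NumberTheory.Automorphic Literature.NumberTheory.Automorphic.UnitaryGroup Literature.NumberTheory.Rogawski1990
open Literature.NumberTheory.GaloisRepresentations
open Summit.HodgeConjecture.HodgeConjecture.Cruxes.H413.F0P3cStCharTSWeylHypMeasure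
open scoped ENNReal NNReal MatrixGroups

namespace Summit.HodgeConjecture.HodgeConjecture.Cruxes.H413.F0P3cStCharTSUpTrJacCartanSplitH

section CM

variable (L : Type) [Field L] [NumberField L] [IsCMField L] (v : HeightOneSpectrum (𝓞 ↥(maximalRealSubfield L)))

/-! ## §1 The (H4s) terminus modulo the `N = 2` split dock -/

set_option maxHeartbeats 1600000 in
set_option synthInstance.maxHeartbeats 400000 in
-- long socket statement on the CM product carrier (class of ★ C8 TERMINUS ∕ ★ (E4) ∕ (H4c-3))
/-- **(H4s) «JAC-H-SPLIT» MODULO THE `N = 2` SPLIT DOCK.**  `H_v = U(Φ₂)_v × U(Φ₁)_v`, `v` non-split (`hns`).  HYPOTHESIS `hDock` = the local tube-Jacobian socket on `U(Φ₂)_v`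
at the split torus `M = (cmBorelTriple L 2 v).M` for ALL Haar data, weight `√(∏|disc|·(∏|det|)⁻¹)`, predicate `IsRegularElt` — the head of (B8-D) `tubeJacobianLocal_cartan_U2_split` (LH6-p04
(g7); road «JAC-LOC₂» (B1)–(B7)).  CONCLUSION = the (H4s) letter (LH6-p03 (g6), 9bf0eb0528a2264c) token for token (binders `{T} (hTM) (hTcl) [..] (Φ) (hΦ) (tm) [..] (htm) (D) (hD)`).
[cite: HarishChandra1970, Lemma 22] [cite: vanDijk1972, §2] [cite: Rogawski1990, §12.5 pp. 182–183; §4.9 p. 54] [cite: Folland1995, §2.6 Thm. 2.49] -/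
theorem tubeJacobianLocal_splitCartanH_of_dock
    (hns : ∀ w : PlacesOver L v, IsCMField.complexConj L • w.1 = w.1)
    (hDock : ∀ [MeasurableSpace ((UnitaryGroup.cmDatum L 2 (Matrix.of fun i j : Fin 2 => if i.val + j.val + 1 = 2 then (1 : L) else 0)).Local v)] [BorelSpace ((UnitaryGroup.cmDatum L 2 (Matrix.of fun i j : Fin 2 => if i.val + j.val + 1 = 2 then (1 : L) else 0)).Local v)]
      {T₂ : Subgroup ((UnitaryGroup.cmDatum L 2 (Matrix.of fun i j : Fin 2 => if i.val + j.val + 1 = 2 then (1 : L) else 0)).Local v)} (_ : T₂ = (cmBorelTriple L 2 v).M)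
      (Φ₂ : (((UnitaryGroup.cmDatum L 2 (Matrix.of fun i j : Fin 2 => if i.val + j.val + 1 = 2 then (1 : L) else 0)).Local v) ⧸ T₂) × ↥T₂ → ((UnitaryGroup.cmDatum L 2 (Matrix.of fun i j : Fin 2 => if i.val + j.val + 1 = 2 then (1 : L) else 0)).Local v)) (_ : ∀ (x : ((UnitaryGroup.cmDatum L 2 (Matrix.of fun i j : Fin 2 => if i.val + j.val + 1 = 2 then (1 : L) else 0)).Local v)) (t : ↥T₂), Φ₂ (QuotientGroup.mk x, t) = x * t * x⁻¹)
      (hT₂c : IsClosed (T₂ : Set ((UnitaryGroup.cmDatum L 2 (Matrix.of fun i j : Fin 2 => if i.val + j.val + 1 = 2 then (1 : L) else 0)).Local v)))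
      [MeasurableSpace (((UnitaryGroup.cmDatum L 2 (Matrix.of fun i j : Fin 2 => if i.val + j.val + 1 = 2 then (1 : L) else 0)).Local v) ⧸ T₂)] [BorelSpace (((UnitaryGroup.cmDatum L 2 (Matrix.of fun i j : Fin 2 => if i.val + j.val + 1 = 2 then (1 : L) else 0)).Local v) ⧸ T₂)]
      (ν₂ : Measure ((UnitaryGroup.cmDatum L 2 (Matrix.of fun i j : Fin 2 => if i.val + j.val + 1 = 2 then (1 : L) else 0)).Local v)) [ν₂.IsHaarMeasure] [ν₂.IsMulRightInvariant]
      (tm₂ : Measure ↥T₂) [tm₂.IsMulLeftInvariant] [IsFiniteMeasureOnCompacts tm₂] [tm₂.IsOpenPosMeasure] [tm₂.IsInvInvariant],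
      ∀ t₀ : ↥T₂, IsRegularElt (((t₀ : ((UnitaryGroup.cmDatum L 2 (Matrix.of fun i j : Fin 2 => if i.val + j.val + 1 = 2 then (1 : L) else 0)).Local v))).val : GL (Fin 2) (UnitaryGroup.LocalRing L v)) →
        ∃ U : Set ↥T₂, IsOpen U ∧ t₀ ∈ U ∧
          ∃ A₀ : Set (((UnitaryGroup.cmDatum L 2 (Matrix.of fun i j : Fin 2 => if i.val + j.val + 1 = 2 then (1 : L) else 0)).Local v) ⧸ T₂), MeasurableSet A₀ ∧ quotientMeasure T₂ tm₂ hT₂c ν₂ A₀ ≠ 0 ∧ quotientMeasure T₂ tm₂ hT₂c ν₂ A₀ ≠ ∞ ∧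
            ∀ V : Set ↥T₂, MeasurableSet V → V ⊆ U → (∀ t ∈ V, IsRegularElt (((t : ((UnitaryGroup.cmDatum L 2 (Matrix.of fun i j : Fin 2 => if i.val + j.val + 1 = 2 then (1 : L) else 0)).Local v))).val : GL (Fin 2) (UnitaryGroup.LocalRing L v))) →
              (∀ n : ((UnitaryGroup.cmDatum L 2 (Matrix.of fun i j : Fin 2 => if i.val + j.val + 1 = 2 then (1 : L) else 0)).Local v), n ∉ T₂ → ∀ t ∈ V, ∀ t' ∈ V, ((t' : ↥T₂) : ((UnitaryGroup.cmDatum L 2 (Matrix.of fun i j : Fin 2 => if i.val + j.val + 1 = 2 then (1 : L) else 0)).Local v)) ≠ n * t * n⁻¹) →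
                ν₂ (Φ₂ '' (A₀ ×ˢ V)) = quotientMeasure T₂ tm₂ hT₂c ν₂ A₀ *
                  ∫⁻ t in V, ((NNReal.sqrt ((∏ w : PlacesOver L v, IsNonarchimedeanLocalField.normAbs (w.1.adicCompletion L) ((((t : ((UnitaryGroup.cmDatum L 2 (Matrix.of fun i j : Fin 2 => if i.val + j.val + 1 = 2 then (1 : L) else 0)).Local v)).val : GL (Fin 2) (UnitaryGroup.LocalRing L v)).val.charpoly.discr) w)) * (∏ w : PlacesOver L v, IsNonarchimedeanLocalField.normAbs (w.1.adicCompletion L) ((((t : ((UnitaryGroup.cmDatum L 2 (Matrix.of fun i j : Fin 2 => if i.val + j.val + 1 = 2 then (1 : L) else 0)).Local v)).val : GL (Fin 2) (UnitaryGroup.LocalRing L v)).val.det) w))⁻¹) : ℝ≥0) : ℝ≥0∞) ∂tm₂)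
    [instM : MeasurableSpace ((UnitaryGroup.cmDatum L 2 (Matrix.of fun i j : Fin 2 => if i.val + j.val + 1 = 2 then (1 : L) else 0)).Local v × (UnitaryGroup.cmDatum L 1 (Matrix.of fun i j : Fin 1 => if i.val + j.val + 1 = 1 then (1 : L) else 0)).Local v)]
    [instB : BorelSpace ((UnitaryGroup.cmDatum L 2 (Matrix.of fun i j : Fin 2 => if i.val + j.val + 1 = 2 then (1 : L) else 0)).Local v × (UnitaryGroup.cmDatum L 1 (Matrix.of fun i j : Fin 1 => if i.val + j.val + 1 = 1 then (1 : L) else 0)).Local v)]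
    [LocallyCompactSpace ((UnitaryGroup.cmDatum L 2 (Matrix.of fun i j : Fin 2 => if i.val + j.val + 1 = 2 then (1 : L) else 0)).Local v × (UnitaryGroup.cmDatum L 1 (Matrix.of fun i j : Fin 1 => if i.val + j.val + 1 = 1 then (1 : L) else 0)).Local v)]
    [SecondCountableTopology ((UnitaryGroup.cmDatum L 2 (Matrix.of fun i j : Fin 2 => if i.val + j.val + 1 = 2 then (1 : L) else 0)).Local v × (UnitaryGroup.cmDatum L 1 (Matrix.of fun i j : Fin 1 => if i.val + j.val + 1 = 1 then (1 : L) else 0)).Local v)]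
    [T2Space ((UnitaryGroup.cmDatum L 2 (Matrix.of fun i j : Fin 2 => if i.val + j.val + 1 = 2 then (1 : L) else 0)).Local v × (UnitaryGroup.cmDatum L 1 (Matrix.of fun i j : Fin 1 => if i.val + j.val + 1 = 1 then (1 : L) else 0)).Local v)]
    (νHv : Measure ((UnitaryGroup.cmDatum L 2 (Matrix.of fun i j : Fin 2 => if i.val + j.val + 1 = 2 then (1 : L) else 0)).Local v × (UnitaryGroup.cmDatum L 1 (Matrix.of fun i j : Fin 1 => if i.val + j.val + 1 = 1 then (1 : L) else 0)).Local v))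
    [νHv.IsHaarMeasure] [νHv.IsMulRightInvariant]
    {T : Subgroup ((UnitaryGroup.cmDatum L 2 (Matrix.of fun i j : Fin 2 => if i.val + j.val + 1 = 2 then (1 : L) else 0)).Local v × (UnitaryGroup.cmDatum L 1 (Matrix.of fun i j : Fin 1 => if i.val + j.val + 1 = 1 then (1 : L) else 0)).Local v)}
    (hTM : T = ((cmBorelTriple L 2 v).M).prod ⊤)
    (hTcl : IsClosed (T : Set ((UnitaryGroup.cmDatum L 2 (Matrix.of fun i j : Fin 2 => if i.val + j.val + 1 = 2 then (1 : L) else 0)).Local v × (UnitaryGroup.cmDatum L 1 (Matrix.of fun i j : Fin 1 => if i.val + j.val + 1 = 1 then (1 : L) else 0)).Local v)))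
    [MeasurableSpace (((UnitaryGroup.cmDatum L 2 (Matrix.of fun i j : Fin 2 => if i.val + j.val + 1 = 2 then (1 : L) else 0)).Local v × (UnitaryGroup.cmDatum L 1 (Matrix.of fun i j : Fin 1 => if i.val + j.val + 1 = 1 then (1 : L) else 0)).Local v) ⧸ T)]
    [BorelSpace (((UnitaryGroup.cmDatum L 2 (Matrix.of fun i j : Fin 2 => if i.val + j.val + 1 = 2 then (1 : L) else 0)).Local v × (UnitaryGroup.cmDatum L 1 (Matrix.of fun i j : Fin 1 => if i.val + j.val + 1 = 1 then (1 : L) else 0)).Local v) ⧸ T)]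
    (Φ : (((UnitaryGroup.cmDatum L 2 (Matrix.of fun i j : Fin 2 => if i.val + j.val + 1 = 2 then (1 : L) else 0)).Local v × (UnitaryGroup.cmDatum L 1 (Matrix.of fun i j : Fin 1 => if i.val + j.val + 1 = 1 then (1 : L) else 0)).Local v) ⧸ T) × ↥T → ((UnitaryGroup.cmDatum L 2 (Matrix.of fun i j : Fin 2 => if i.val + j.val + 1 = 2 then (1 : L) else 0)).Local v × (UnitaryGroup.cmDatum L 1 (Matrix.of fun i j : Fin 1 => if i.val + j.val + 1 = 1 then (1 : L) else 0)).Local v))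
    (hΦ : ∀ (x : ((UnitaryGroup.cmDatum L 2 (Matrix.of fun i j : Fin 2 => if i.val + j.val + 1 = 2 then (1 : L) else 0)).Local v × (UnitaryGroup.cmDatum L 1 (Matrix.of fun i j : Fin 1 => if i.val + j.val + 1 = 1 then (1 : L) else 0)).Local v)) (t : ↥T), Φ (QuotientGroup.mk x, t) = x * t * x⁻¹)
    (tm : Measure ↥T) [tm.IsHaarMeasure] [tm.IsInvInvariant] (_htm : tm (compactCore ↥T) = 1)
    (D : ↥T → ℝ≥0)
    (hD : ∀ t : ↥T, (D t : ℝ) =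
      ((NNReal.sqrt (NNReal.sqrt ((∏ w : PlacesOver L v, IsNonarchimedeanLocalField.normAbs (w.1.adicCompletion L) (((((t : ((UnitaryGroup.cmDatum L 2 (Matrix.of fun i j : Fin 2 => if i.val + j.val + 1 = 2 then (1 : L) else 0)).Local v × (UnitaryGroup.cmDatum L 1 (Matrix.of fun i j : Fin 1 => if i.val + j.val + 1 = 1 then (1 : L) else 0)).Local v))).1.val : GL (Fin 2) (UnitaryGroup.LocalRing L v)).val.charpoly.discr) w)) * (∏ w : PlacesOver L v, IsNonarchimedeanLocalField.normAbs (w.1.adicCompletion L) (((((t : ((UnitaryGroup.cmDatum L 2 (Matrix.of fun i j : Fin 2 => if i.val + j.val + 1 = 2 then (1 : L) else 0)).Local v × (UnitaryGroup.cmDatum L 1 (Matrix.of fun i j : Fin 1 => if i.val + j.val + 1 = 1 then (1 : L) else 0)).Local v))).1.val : GL (Fin 2) (UnitaryGroup.LocalRing L v)).val.det) w))⁻¹)) : ℝ≥0) : ℝ) ^ 2) :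
    ∀ t₀ : ↥T, IsLocalGRegular L v (t₀ : ((UnitaryGroup.cmDatum L 2 (Matrix.of fun i j : Fin 2 => if i.val + j.val + 1 = 2 then (1 : L) else 0)).Local v × (UnitaryGroup.cmDatum L 1 (Matrix.of fun i j : Fin 1 => if i.val + j.val + 1 = 1 then (1 : L) else 0)).Local v)) →
      ∃ U : Set ↥T, IsOpen U ∧ t₀ ∈ U ∧
        ∃ A₀ : Set (((UnitaryGroup.cmDatum L 2 (Matrix.of fun i j : Fin 2 => if i.val + j.val + 1 = 2 then (1 : L) else 0)).Local v × (UnitaryGroup.cmDatum L 1 (Matrix.of fun i j : Fin 1 => if i.val + j.val + 1 = 1 then (1 : L) else 0)).Local v) ⧸ T), MeasurableSet A₀ ∧ quotientMeasure T tm hTcl νHv A₀ ≠ 0 ∧ quotientMeasure T tm hTcl νHv A₀ ≠ ∞ ∧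
          ∀ V : Set ↥T, MeasurableSet V → V ⊆ U →
            (∀ t ∈ V, IsLocalGRegular L v (t : ((UnitaryGroup.cmDatum L 2 (Matrix.of fun i j : Fin 2 => if i.val + j.val + 1 = 2 then (1 : L) else 0)).Local v × (UnitaryGroup.cmDatum L 1 (Matrix.of fun i j : Fin 1 => if i.val + j.val + 1 = 1 then (1 : L) else 0)).Local v))) →
            (∀ n : ((UnitaryGroup.cmDatum L 2 (Matrix.of fun i j : Fin 2 => if i.val + j.val + 1 = 2 then (1 : L) else 0)).Local v × (UnitaryGroup.cmDatum L 1 (Matrix.of fun i j : Fin 1 => if i.val + j.val + 1 = 1 then (1 : L) else 0)).Local v), n ∉ T → ∀ t ∈ V, ∀ t' ∈ V, ((t' : ↥T) : ((UnitaryGroup.cmDatum L 2 (Matrix.of fun i j : Fin 2 => if i.val + j.val + 1 = 2 then (1 : L) else 0)).Local v × (UnitaryGroup.cmDatum L 1 (Matrix.of fun i j : Fin 1 => if i.val + j.val + 1 = 1 then (1 : L) else 0)).Local v)) ≠ n * t * n⁻¹) →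
              νHv (Φ '' (A₀ ×ˢ V)) = quotientMeasure T tm hTcl νHv A₀ * ∫⁻ t in V, (D t : ℝ≥0∞) ∂tm := by
  intro t₀ ht₀
  classical
  /- ### Borel structures on the factors; the product structure IS the given one -/
  letI mTwo : MeasurableSpace ((UnitaryGroup.cmDatum L 2 (Matrix.of fun i j : Fin 2 => if i.val + j.val + 1 = 2 then (1 : L) else 0)).Local v) := borel _
  haveI bTwo : BorelSpace ((UnitaryGroup.cmDatum L 2 (Matrix.of fun i j : Fin 2 => if i.val + j.val + 1 = 2 then (1 : L) else 0)).Local v) := ⟨rfl⟩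
  letI mOne : MeasurableSpace ((UnitaryGroup.cmDatum L 1 (Matrix.of fun i j : Fin 1 => if i.val + j.val + 1 = 1 then (1 : L) else 0)).Local v) := borel _
  haveI bOne : BorelSpace ((UnitaryGroup.cmDatum L 1 (Matrix.of fun i j : Fin 1 => if i.val + j.val + 1 = 1 then (1 : L) else 0)).Local v) := ⟨rfl⟩
  have hinst : instM = Prod.instMeasurableSpace := by
    rw [instB.measurable_eq]
    exact (Prod.borelSpace (α := ((UnitaryGroup.cmDatum L 2 (Matrix.of fun i j : Fin 2 => if i.val + j.val + 1 = 2 then (1 : L) else 0)).Local v)) (β := ((UnitaryGroup.cmDatum L 1 (Matrix.of fun i j : Fin 1 => if i.val + j.val + 1 = 1 then (1 : L) else 0)).Local v))).measurable_eq.symm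
  subst hinst
  /- ### the split torus `M` as a subgroup of the `cmDatum` carrier -/
  obtain ⟨T₂, hT₂⟩ : ∃ T₂ : Subgroup ((UnitaryGroup.cmDatum L 2 (Matrix.of fun i j : Fin 2 => if i.val + j.val + 1 = 2 then (1 : L) else 0)).Local v), T₂ = (cmBorelTriple L 2 v).M := ⟨_, rfl⟩
  have hT : T = T₂.prod ⊤ := by rw [hT₂]; exact hTM
  /- ### the place `w ∣ v`, compactness and commutativity of `U(Φ₁)_v`, commutativity and closedness of `M` -/
  obtain ⟨w⟩ := (inferInstance : Nonempty (PlacesOver L v))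
  haveI : CompactSpace ((UnitaryGroup.cmDatum L 1 (Matrix.of fun i j : Fin 1 => if i.val + j.val + 1 = 1 then (1 : L) else 0)).Local v) := compactSpace_cmDatum_local_one_of_smul_eq L v w (hns w)
  have hK : ∀ a b : ((UnitaryGroup.cmDatum L 1 (Matrix.of fun i j : Fin 1 => if i.val + j.val + 1 = 1 then (1 : L) else 0)).Local v), a * b = b * a := F0P3cStCharTSUpTrJacCartanCompactH.mul_comm_cmDatum_local_one L v
  have hab₂ : ∀ a ∈ T₂, ∀ b ∈ T₂, a * b = b * a := by
    intro a ha b hb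
    rw [hT₂] at ha hb
    exact congrArg Subtype.val (torusU_mul_comm _ _ ⟨a, ha⟩ ⟨b, hb⟩)
  have hMc : IsClosed (T₂ : Set ((UnitaryGroup.cmDatum L 2 (Matrix.of fun i j : Fin 2 => if i.val + j.val + 1 = 2 then (1 : L) else 0)).Local v)) := by
    rw [hT₂]; exact isClosed_torusU_of_t1Space _ _
  /- ### the conjugation family of `M` -/
  obtain ⟨Φ₂, hΦ₂⟩ := exists_conjFamily T₂ hab₂
  letI : MeasurableSpace (((UnitaryGroup.cmDatum L 2 (Matrix.of fun i j : Fin 2 => if i.val + j.val + 1 = 2 then (1 : L) else 0)).Local v) ⧸ T₂) := borel _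
  haveI : BorelSpace (((UnitaryGroup.cmDatum L 2 (Matrix.of fun i j : Fin 2 => if i.val + j.val + 1 = 2 then (1 : L) else 0)).Local v) ⧸ T₂) := ⟨rfl⟩
  /- ### the torus measure: Haar ⇒ the four classes -/
  haveI : IsFiniteMeasureOnCompacts tm := inferInstance
  haveI : tm.IsOpenPosMeasure := inferInstance
  /- ### the weight in `ℝ≥0` -/
  have hD' : ∀ t : ↥T,
      D t = (fun g : ((UnitaryGroup.cmDatum L 2 (Matrix.of fun i j : Fin 2 => if i.val + j.val + 1 = 2 then (1 : L) else 0)).Local v) => NNReal.sqrt ((∏ w : PlacesOver L v, IsNonarchimedeanLocalField.normAbs (w.1.adicCompletion L) ((((g : ((UnitaryGroup.cmDatum L 2 (Matrix.of fun i j : Fin 2 => if i.val + j.val + 1 = 2 then (1 : L) else 0)).Local v)).val : GL (Fin 2) (UnitaryGroup.LocalRing L v)).val.charpoly.discr) w)) * (∏ w : PlacesOver L v, IsNonarchimedeanLocalField.normAbs (w.1.adicCompletion L) ((((g : ((UnitaryGroup.cmDatum L 2 (Matrix.of fun i j : Fin 2 => if i.val + j.val + 1 = 2 then (1 : L) else 0)).Local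 v)).val : GL (Fin 2) (UnitaryGroup.LocalRing L v)).val.det) w))⁻¹)) (t : ((UnitaryGroup.cmDatum L 2 (Matrix.of fun i j : Fin 2 => if i.val + j.val + 1 = 2 then (1 : L) else 0)).Local v × (UnitaryGroup.cmDatum L 1 (Matrix.of fun i j : Fin 1 => if i.val + j.val + 1 = 1 then (1 : L) else 0)).Local v)).1 := by
    intro t
    apply NNReal.coe_injective
    rw [hD t, ← NNReal.coe_pow, NNReal.sq_sqrt]
  /- ### the generic product theorem -/
  exact tubeJacobianLocal_prod_compactFactor (G₂ := ((UnitaryGroup.cmDatum L 2 (Matrix.of fun i j : Fin 2 => if i.val + j.val + 1 = 2 then (1 : L) else 0)).Local v)) (K := ((UnitaryGroup.cmDatum L 1 (Matrix.of fun i j : Fin 1 => if i.val + j.val + 1 = 1 then (1 : L) else 0)).Local v)) hab₂ hK Φ₂ hΦ₂ hMc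
    (fun g : ((UnitaryGroup.cmDatum L 2 (Matrix.of fun i j : Fin 2 => if i.val + j.val + 1 = 2 then (1 : L) else 0)).Local v) => IsRegularElt (g.val : GL (Fin 2) (UnitaryGroup.LocalRing L v)))
    (fun g : ((UnitaryGroup.cmDatum L 2 (Matrix.of fun i j : Fin 2 => if i.val + j.val + 1 = 2 then (1 : L) else 0)).Local v) => NNReal.sqrt ((∏ w : PlacesOver L v, IsNonarchimedeanLocalField.normAbs (w.1.adicCompletion L) ((((g : ((UnitaryGroup.cmDatum L 2 (Matrix.of fun i j : Fin 2 => if i.val + j.val + 1 = 2 then (1 : L) else 0)).Local v)).val : GL (Fin 2) (UnitaryGroup.LocalRing L v)).val.charpoly.discr) w)) * (∏ w : PlacesOver L v, IsNonarchimedeanLocalField.normAbs (w.1.adicCompletion L) ((((g : ((UnitaryGroup.cmDatum L 2 (Matrix.of fun i j : Fin 2 => if i.val + j.val + 1 = 2 then (1 : L) else 0)).Local v)).val : GL (Fin 2) (UnitaryGroup.LocalRing L v)).val.det) w))⁻¹))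
    (F0P3cStCharTSUpTrJacCartanCompactH.measurable_sqrt_radicandTwo L v)
    (fun ν₂ _ _ tm₂ _ _ _ _ => hDock hT₂ Φ₂ hΦ₂ hMc ν₂ tm₂)
    hT hTcl Φ hΦ νHv tm (IsLocalGRegular L v) (fun p hp => F0P3cStCharTSUpTrJacCartanCompactH.isRegularElt_fst_of_isLocalGRegular L v hp) D hD' t₀ ht₀

/-! ## §2 The (H4s) terminus, unconditional (ED. 2: `hDock` := ★ (B8-D) FILE A `…SplitModelTwo.tubeJacobianLocal_splitCartan_U2`) -/

set_option maxHeartbeats 1600000 in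
set_option synthInstance.maxHeartbeats 400000 in
-- long socket statement on the CM product carrier (class of ★ C8 TERMINUS ∕ ★ (E4) ∕ (H4c-3))
/-- **(H4s) «JAC-H-SPLIT» — THE SPLIT-CARTAN TUBE-JACOBIAN SOCKET ON `H_v = U(Φ₂)(L⁺_v) × U(Φ₁)(L⁺_v)`, IN THE SIGNED LETTERS, UNCONDITIONAL** (LH6-p03 (g6),
sigsheet 9bf0eb0528a2264c, token for token): §1 with `hDock :=` ★ (B8-D) FILE A `F0P3cStCharTSUpTrJacSplitModelTwo.tubeJacobianLocal_splitCartan_U2` (LH6-p04 (g7)) = ★ (B7) `tubeJacobianLocal_torusU_of_orbitTube` ∘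
★ (B7b) `horbit_torusU_two` ∘ ★ (B5-M) `measure_boxProduct_eq_weight_mul_measure_level` (with ★ (B5) ⊆, ★ (B6) ⊇, ★ (B2) levels∕boxes, ★ (B4) Weyl index, ★ (B3) isometry) on the model
`U(σ_w, Φ₂)(L_w)`, docked to the CM carrier by ★ (B8-D) FILE B `…SplitDockTwo` (★ Q9 transport, ★ (B8a) weight dictionary).  ROAD «JAC-LOC₂» memo: `F0/P3c/LH7/LH7-p02/g8/h4s/ROAD-JAC-LOC2.v1.LH7p02g8.md`.  [cite: HarishChandra1970, Lemma 22] [cite: vanDijk1972, §2] [cite: Rogawski1990, §12.5 pp. 182–183; §4.9 p. 54] -/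
theorem tubeJacobianLocal_splitCartanH
    (hns : ∀ w : PlacesOver L v, IsCMField.complexConj L • w.1 = w.1)
    [instM : MeasurableSpace ((UnitaryGroup.cmDatum L 2 (Matrix.of fun i j : Fin 2 => if i.val + j.val + 1 = 2 then (1 : L) else 0)).Local v × (UnitaryGroup.cmDatum L 1 (Matrix.of fun i j : Fin 1 => if i.val + j.val + 1 = 1 then (1 : L) else 0)).Local v)]
    [instB : BorelSpace ((UnitaryGroup.cmDatum L 2 (Matrix.of fun i j : Fin 2 => if i.val + j.val + 1 = 2 then (1 : L) else 0)).Local v × (UnitaryGroup.cmDatum L 1 (Matrix.of fun i j : Fin 1 => if i.val + j.val + 1 = 1 then (1 : L) else 0)).Local v)]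
    [LocallyCompactSpace ((UnitaryGroup.cmDatum L 2 (Matrix.of fun i j : Fin 2 => if i.val + j.val + 1 = 2 then (1 : L) else 0)).Local v × (UnitaryGroup.cmDatum L 1 (Matrix.of fun i j : Fin 1 => if i.val + j.val + 1 = 1 then (1 : L) else 0)).Local v)]
    [SecondCountableTopology ((UnitaryGroup.cmDatum L 2 (Matrix.of fun i j : Fin 2 => if i.val + j.val + 1 = 2 then (1 : L) else 0)).Local v × (UnitaryGroup.cmDatum L 1 (Matrix.of fun i j : Fin 1 => if i.val + j.val + 1 = 1 then (1 : L) else 0)).Local v)]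
    [T2Space ((UnitaryGroup.cmDatum L 2 (Matrix.of fun i j : Fin 2 => if i.val + j.val + 1 = 2 then (1 : L) else 0)).Local v × (UnitaryGroup.cmDatum L 1 (Matrix.of fun i j : Fin 1 => if i.val + j.val + 1 = 1 then (1 : L) else 0)).Local v)]
    (νHv : Measure ((UnitaryGroup.cmDatum L 2 (Matrix.of fun i j : Fin 2 => if i.val + j.val + 1 = 2 then (1 : L) else 0)).Local v × (UnitaryGroup.cmDatum L 1 (Matrix.of fun i j : Fin 1 => if i.val + j.val + 1 = 1 then (1 : L) else 0)).Local v))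
    [νHv.IsHaarMeasure] [νHv.IsMulRightInvariant]
    {T : Subgroup ((UnitaryGroup.cmDatum L 2 (Matrix.of fun i j : Fin 2 => if i.val + j.val + 1 = 2 then (1 : L) else 0)).Local v × (UnitaryGroup.cmDatum L 1 (Matrix.of fun i j : Fin 1 => if i.val + j.val + 1 = 1 then (1 : L) else 0)).Local v)}
    (hTM : T = ((cmBorelTriple L 2 v).M).prod ⊤)
    (hTcl : IsClosed (T : Set ((UnitaryGroup.cmDatum L 2 (Matrix.of fun i j : Fin 2 => if i.val + j.val + 1 = 2 then (1 : L) else 0)).Local v × (UnitaryGroup.cmDatum L 1 (Matrix.of fun i j : Fin 1 => if i.val + j.val + 1 = 1 then (1 : L) else 0)).Local v)))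
    [MeasurableSpace (((UnitaryGroup.cmDatum L 2 (Matrix.of fun i j : Fin 2 => if i.val + j.val + 1 = 2 then (1 : L) else 0)).Local v × (UnitaryGroup.cmDatum L 1 (Matrix.of fun i j : Fin 1 => if i.val + j.val + 1 = 1 then (1 : L) else 0)).Local v) ⧸ T)]
    [BorelSpace (((UnitaryGroup.cmDatum L 2 (Matrix.of fun i j : Fin 2 => if i.val + j.val + 1 = 2 then (1 : L) else 0)).Local v × (UnitaryGroup.cmDatum L 1 (Matrix.of fun i j : Fin 1 => if i.val + j.val + 1 = 1 then (1 : L) else 0)).Local v) ⧸ T)]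
    (Φ : (((UnitaryGroup.cmDatum L 2 (Matrix.of fun i j : Fin 2 => if i.val + j.val + 1 = 2 then (1 : L) else 0)).Local v × (UnitaryGroup.cmDatum L 1 (Matrix.of fun i j : Fin 1 => if i.val + j.val + 1 = 1 then (1 : L) else 0)).Local v) ⧸ T) × ↥T → ((UnitaryGroup.cmDatum L 2 (Matrix.of fun i j : Fin 2 => if i.val + j.val + 1 = 2 then (1 : L) else 0)).Local v × (UnitaryGroup.cmDatum L 1 (Matrix.of fun i j : Fin 1 => if i.val + j.val + 1 = 1 then (1 : L) else 0)).Local v))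
    (hΦ : ∀ (x : ((UnitaryGroup.cmDatum L 2 (Matrix.of fun i j : Fin 2 => if i.val + j.val + 1 = 2 then (1 : L) else 0)).Local v × (UnitaryGroup.cmDatum L 1 (Matrix.of fun i j : Fin 1 => if i.val + j.val + 1 = 1 then (1 : L) else 0)).Local v)) (t : ↥T), Φ (QuotientGroup.mk x, t) = x * t * x⁻¹)
    (tm : Measure ↥T) [tm.IsHaarMeasure] [tm.IsInvInvariant] (htm : tm (compactCore ↥T) = 1)
    (D : ↥T → ℝ≥0)
    (hD : ∀ t : ↥T, (D t : ℝ) =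
      ((NNReal.sqrt (NNReal.sqrt ((∏ w : PlacesOver L v, IsNonarchimedeanLocalField.normAbs (w.1.adicCompletion L) (((((t : ((UnitaryGroup.cmDatum L 2 (Matrix.of fun i j : Fin 2 => if i.val + j.val + 1 = 2 then (1 : L) else 0)).Local v × (UnitaryGroup.cmDatum L 1 (Matrix.of fun i j : Fin 1 => if i.val + j.val + 1 = 1 then (1 : L) else 0)).Local v))).1.val : GL (Fin 2) (UnitaryGroup.LocalRing L v)).val.charpoly.discr) w)) * (∏ w : PlacesOver L v, IsNonarchimedeanLocalField.normAbs (w.1.adicCompletion L) (((((t : ((UnitaryGroup.cmDatum L 2 (Matrix.of fun i j : Fin 2 => if i.val + j.val + 1 = 2 then (1 : L) else 0)).Local v × (UnitaryGroup.cmDatum L 1 (Matrix.of fun i j : Fin 1 => if i.val + j.val + 1 = 1 then (1 : L) else 0)).Local v))).1.val : GL (Fin 2) (UnitaryGroup.LocalRing L v)).val.det) w))⁻¹)) : ℝ≥0) : ℝ) ^ 2) :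
    ∀ t₀ : ↥T, IsLocalGRegular L v (t₀ : ((UnitaryGroup.cmDatum L 2 (Matrix.of fun i j : Fin 2 => if i.val + j.val + 1 = 2 then (1 : L) else 0)).Local v × (UnitaryGroup.cmDatum L 1 (Matrix.of fun i j : Fin 1 => if i.val + j.val + 1 = 1 then (1 : L) else 0)).Local v)) →
      ∃ U : Set ↥T, IsOpen U ∧ t₀ ∈ U ∧
        ∃ A₀ : Set (((UnitaryGroup.cmDatum L 2 (Matrix.of fun i j : Fin 2 => if i.val + j.val + 1 = 2 then (1 : L) else 0)).Local v × (UnitaryGroup.cmDatum L 1 (Matrix.of fun i j : Fin 1 => if i.val + j.val + 1 = 1 then (1 : L) else 0)).Local v) ⧸ T), MeasurableSet A₀ ∧ quotientMeasure T tm hTcl νHv A₀ ≠ 0 ∧ quotientMeasure T tm hTcl νHv A₀ ≠ ∞ ∧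
          ∀ V : Set ↥T, MeasurableSet V → V ⊆ U →
            (∀ t ∈ V, IsLocalGRegular L v (t : ((UnitaryGroup.cmDatum L 2 (Matrix.of fun i j : Fin 2 => if i.val + j.val + 1 = 2 then (1 : L) else 0)).Local v × (UnitaryGroup.cmDatum L 1 (Matrix.of fun i j : Fin 1 => if i.val + j.val + 1 = 1 then (1 : L) else 0)).Local v))) →
            (∀ n : ((UnitaryGroup.cmDatum L 2 (Matrix.of fun i j : Fin 2 => if i.val + j.val + 1 = 2 then (1 : L) else 0)).Local v × (UnitaryGroup.cmDatum L 1 (Matrix.of fun i j : Fin 1 => if i.val + j.val + 1 = 1 then (1 : L) else 0)).Local v), n ∉ T → ∀ t ∈ V, ∀ t' ∈ V, ((t' : ↥T) : ((UnitaryGroup.cmDatum L 2 (Matrix.of fun i j : Fin 2 => if i.val + j.val + 1 = 2 then (1 : L) else 0)).Local v × (UnitaryGroup.cmDatum L 1 (Matrix.of fun i j : Fin 1 => if i.val + j.val + 1 = 1 then (1 : L) else 0)).Local v)) ≠ n * t * n⁻¹) →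
              νHv (Φ '' (A₀ ×ˢ V)) = quotientMeasure T tm hTcl νHv A₀ * ∫⁻ t in V, (D t : ℝ≥0∞) ∂tm :=
  tubeJacobianLocal_splitCartanH_of_dock L v hns (F0P3cStCharTSUpTrJacSplitModelTwo.tubeJacobianLocal_splitCartan_U2 L v hns)
    νHv hTM hTcl Φ hΦ tm htm D hD

end CM

end Summit.HodgeConjecture.HodgeConjecture.Cruxes.H413.F0P3cStCharTSUpTrJacCartanSplitH

end
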